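import Summits.FinalStateConjecture.FinalStateConjecture.Theorems.ZeroEnergyKerrOrBombHawkingExtensionIsKerrHRAssemblyPrep
import Summits.FinalStateConjecture.FinalStateConjecture.Theorems.ZeroEnergyKerrOrBombHawkingExtensionIsKerrHRBootstrap
import Summits.FinalStateConjecture.FinalStateConjecture.Theorems.ZeroEnergyKerrOrBombHawkingExtensionIsKerrHRSandwich
import Summits.FinalStateConjecture.FinalStateConjecture.Theorems.ZeroEnergyKerrOrBombHawkingExtensionIsKerrHRHeightDeriv
import Summits.FinalStateConjecture.FinalStateConjecture.Theorems.ZeroEnergyKerrOrBombHawkingExtensionIsKerrHRSlopeField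
import HarnessLib

/-!
# Crux `HawkingExtensionIsKerr` (stmt-FinalStateConjecture-17840), line `SketchIdeator2` —
# programme HR (horizon regularity): the assembly — smooth local defining functions of the event
# horizon of a stationary black hole carrying a tangent null field

Helper file of the line lead (c4), registered sub-goal `stub_hr_assembly`.  THE THEOREM
(`exists_horizonDefiningFunction`): for a `StationaryAFBlackHole` and a smooth field `K` on an open
`U ⊇ 𝓔⁺` which on `𝓔⁺ = ∂I⁻(M_ext) ∩ I⁺(M_ext)` is null, nowhere zero and locally tangent (short
integral curves from horizon points stay in `𝓔⁺`), the horizon is a SMOOTH hypersurface: about each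
`p ∈ 𝓔⁺` there are an open `W ∋ p`, `W ⊆ U`, and `F ∈ C^∞(W)` with `𝓔⁺ ∩ W = {F = 0}`,
`⟨⟨M_ext⟩⟩ ∩ W = {F < 0}`, `dF = c g(K, ·)`, `c ≠ 0`, along `𝓔⁺ ∩ W` (Chruściel–Costa 2008 Thm 4.11
obtain smoothness via the area theorem; here it comes from causality alone, as in Beem–Królak,
J. Math. Phys. 39 (1998) 6001, Thm 3.5).  PROOF from the landed bricks, taken as hypotheses in their
registered forms: in the box of Hawking–Ellis' Prop. 6.3.1 about `p` for the future set
`S = (I⁻(M_ext))ᶜ` (tree `AchronalBoundaryProofs`), shrunk into `U ∩ I⁺(M_ext)`, the null sandwich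
(`…HRSandwich`, fed with the future-directed one of `±K`, `…HRAssemblyPrep`) and `…HRHeightDeriv`
give `Du(y) = G(y, u(y))` for the height `u`, with `G` the slope field of `…HRSlopeField`, so
`…HRBootstrap` makes `u` smooth; `F := ℓ(φ − φ p) − u(A(φ − φ p))` is the defining function.
-/

noncomputable section

set_option linter.dupNamespace false

namespace Summit.FinalStateConjecture.FinalStateConjecture.Theorems.HawkingExtensionIsKerr.SketchIdeator2

open Set Filter Metric Bundle Function Literature.Geometry.Lorentzian LorentzianMetric
open scoped Manifold ContDiff Topology

set_option maxHeartbeats 1600000 in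
/-- **HR assembly: smooth local defining functions of the event horizon** from the HR bricks
(bootstrap, sandwich, height derivative, slope field): in the box of Hawking–Ellis' Prop. 6.3.1
about `p ∈ 𝓔⁺` for `S = (I⁻(M_ext))ᶜ`, shrunk into `U ∩ I⁺(M_ext)`, the height `u` of the graph
`𝓔⁺` satisfies `Du = G(·, u)` (sandwich + brick D at each graph point, `G` the slope field), hence
is smooth (brick B), and `F := ℓ(φ − φ p) − u(A(φ − φ p))` (`φ` the chart at `p`) vanishes
exactly on `𝓔⁺`, is negative exactly on `⟨⟨M_ext⟩⟩`, and has `dF = (Λ v)⁻¹ Λ ∘ dφ = c g(K, ·)`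
along `𝓔⁺`. -/
theorem exists_horizonDefiningFunction
    (hB : ∀ (u : E3 → ℝ) (G : E3 × ℝ → E3 →L[ℝ] ℝ) (D : Set E3) (Ω : Set (E3 × ℝ)), IsOpen D → IsOpen Ω → ContinuousOn u D → (∀ y ∈ D, (y, u y) ∈ Ω) → ContDiffOn ℝ ∞ G Ω → (∀ y ∈ D, HasFDerivAt u (G (y, u y)) y) → ContDiffOn ℝ ∞ u D)
    (hS : ∀ (𝓑 : StationaryAFBlackHole.{0}) (p x₀ : 𝓑.carrier) (L : TangentSpace (𝓡 4) x₀) (γ : ℝ → 𝓑.carrier) (ε : ℝ), x₀ ∈ (chartAt E4 p).source → 0 < ε → γ 0 = x₀ → HasMFDerivAt 𝓘(ℝ, ℝ) (𝓡 4) γ 0 ((1 : ℝ →L[ℝ] ℝ).smulRight L) → 𝓑.metric.val x₀ L L = 0 → 𝓑.metric.val x₀ (𝓑.timeOrientation.vectorField x₀) L < 0 → (∀ t ∈ Set.Ioo (-ε) ε, γ t ∈ frontier (𝓑.metric.chronologicalPast 𝓑.timeOrientation 𝓑.Mext)) → ∀ μ : ℝ, 0 < μ → ∀ᶠ z in 𝓝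 (extChartAt (𝓡 4) p x₀), (extChartAt (𝓡 4) p).symm z ∈ frontier (𝓑.metric.chronologicalPast 𝓑.timeOrientation 𝓑.Mext) → |𝓑.metric.val x₀ ((trivializationAt E4 (TangentSpace (𝓡 4)) p).symmL ℝ x₀ (z - extChartAt (𝓡 4) p x₀)) L| ≤ μ * ‖z - extChartAt (𝓡 4) p x₀‖)
    (hD : ∀ (𝓑 : StationaryAFBlackHole.{0}) (q : 𝓑.carrier) (v : E4) (ρ δ ε : ℝ) (P : E4 → ℝ → 𝓑.carrier) (S : Set 𝓑.carrier) (Bm : E3 →L[ℝ] E4) (y₁ : E3) (Λ : E4 →L[ℝ] ℝ), (∀ y t, P y t = (extChartAt (𝓡 4) q).symm (extChartAt (𝓡 4) q q + y + t • v)) → (∀ z u : E4, ‖z - extChartAt (𝓡 4) q q‖ < ρ → ‖u - v‖ < ρ → (z, u) ∈ LorentzianMetric.chartCone 𝓑.metric 𝓑.timeOrientation q) → δ * ‖v‖ ≤ ρ / 2 → 𝓑.metric.IsFutureSet 𝓑.timeOrientation S → ε ≤ ρ / 2 → 0 < δ → (∀ y : E4, ‖y‖ < ε → P y δ ∈ interior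 S) → (∀ y : E4, ‖y‖ < ε → P y (-δ) ∈ interior Sᶜ) → ‖Bm y₁‖ < ε → Λ v ≠ 0 → (∀ μ : ℝ, 0 < μ → ∀ᶠ z in 𝓝 (extChartAt (𝓡 4) q q + Bm y₁ + (sInf {t : ℝ | t ∈ Set.Icc (-δ) δ ∧ P (Bm y₁) t ∈ S}) • v), (extChartAt (𝓡 4) q).symm z ∈ frontier S → |Λ (z - (extChartAt (𝓡 4) q q + Bm y₁ + (sInf {t : ℝ | t ∈ Set.Icc (-δ) δ ∧ P (Bm y₁) t ∈ S}) • v))| ≤ μ * ‖z - (extChartAt (𝓡 4) q q + Bm y₁ + (sInf {t : ℝ | t ∈ Set.Icc (-δ) δ ∧ P (Bm y₁) t ∈ S}) • v)‖) → HasFDerivAt (fun y : E3 ↦ sInf {t : ℝ | t ∈ Set.Icc (-δ) δ ∧ P (Bm y) t ∈ S}) (-(Λ v)⁻¹ • (Λ.comp Bm)) y₁)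
    (hG : ∀ (𝓑 : StationaryAFBlackHole.{0}) (U : Set 𝓑.carrier) (K : Π x : 𝓑.carrier, TangentSpace (𝓡 4) x) (p : 𝓑.carrier) (B : E3 →L[ℝ] E4) (z₀ v : E4), IsOpen U → ContMDiffOn (𝓡 4) ((𝓡 4).prod 𝓘(ℝ, E4)) ((⊤ : ℕ∞) : WithTop ℕ∞) (fun x ↦ (Bundle.TotalSpace.mk' E4 x (K x) : TangentBundle (𝓡 4) 𝓑.carrier)) U → IsOpen {w : E3 × ℝ | (z₀ + B w.1 + w.2 • v ∈ (extChartAt (𝓡 4) p).target ∧ (extChartAt (𝓡 4) p).symm (z₀ + B w.1 + w.2 • v) ∈ U) ∧ 𝓑.metric.val ((extChartAt (𝓡 4) p).symm (z₀ + B w.1 + w.2 • v)) ((trivializationAt E4 (TangentSpace (𝓡 4)) p).symmL ℝ ((extChartAt (𝓡 4) p).symm (z₀ + B w.1 + w.2 • v)) v) (K ((extChartAt (𝓡 4) p).symm (z₀ + B w.1 + w.2 • v))) ≠ 0} ∧ ContDiffOn ℝ ((⊤ : ℕ∞) : WithTop ℕ∞) (fun w : E3 × ℝ ↦ -(𝓑.metric.val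 ((extChartAt (𝓡 4) p).symm (z₀ + B w.1 + w.2 • v)) ((trivializationAt E4 (TangentSpace (𝓡 4)) p).symmL ℝ ((extChartAt (𝓡 4) p).symm (z₀ + B w.1 + w.2 • v)) v) (K ((extChartAt (𝓡 4) p).symm (z₀ + B w.1 + w.2 • v))))⁻¹ • ((𝓑.metric.val ((extChartAt (𝓡 4) p).symm (z₀ + B w.1 + w.2 • v)) (K ((extChartAt (𝓡 4) p).symm (z₀ + B w.1 + w.2 • v)))).comp (((trivializationAt E4 (TangentSpace (𝓡 4)) p).symmL ℝ ((extChartAt (𝓡 4) p).symm (z₀ + B w.1 + w.2 • v))).comp B))) {w : E3 × ℝ | (z₀ + B w.1 + w.2 • v ∈ (extChartAt (𝓡 4) p).target ∧ (extChartAt (𝓡 4) p).symm (z₀ + B w.1 + w.2 • v) ∈ U) ∧ 𝓑.metric.val ((extChartAt (𝓡 4) p).symm (z₀ + B w.1 + w.2 • v)) ((trivializationAt E4 (TangentSpace (𝓡 4)) p).symmL ℝ ((extChartAt (𝓡 4) p).symm (z₀ + B w.1 + w.2 • v)) v) (K ((extChartAt (𝓡 4) p).symm (z₀ + B w.1 +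 w.2 • v))) ≠ 0}) :
    ∀ (𝓑 : StationaryAFBlackHole.{0}) (U : Set 𝓑.carrier) (K : Π x : 𝓑.carrier, TangentSpace (𝓡 4) x), IsOpen U → 𝓑.horizon ⊆ U → ContMDiffOn (𝓡 4) ((𝓡 4).prod 𝓘(ℝ, E4)) ((⊤ : ℕ∞) : WithTop ℕ∞) (fun x ↦ (Bundle.TotalSpace.mk' E4 x (K x) : TangentBundle (𝓡 4) 𝓑.carrier)) U → (∀ p ∈ 𝓑.horizon, K p ≠ 0) → (∀ p ∈ 𝓑.horizon, 𝓑.metric.val p (K p) (K p) = 0) → (∀ p ∈ 𝓑.horizon, ∃ ε > (0 : ℝ), ∃ γ : ℝ → 𝓑.carrier, γ 0 = p ∧ IsMIntegralCurveOn γ K (Set.Ioo (-ε) ε) ∧ ∀ t ∈ Set.Ioo (-ε) ε, γ t ∈ 𝓑.horizon) → ∀ p ∈ 𝓑.horizon, ∃ W : Set 𝓑.carrier, IsOpen W ∧ p ∈ W ∧ W ⊆ U ∧ ∃ F : 𝓑.carrier → ℝ, ContMDiffOn (𝓡 4) 𝓘(ℝ, ℝ) ((⊤ : ℕ∞) : WithTop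 ℕ∞) F W ∧ (∀ x ∈ W, x ∈ 𝓑.horizon ↔ F x = 0) ∧ (∀ x ∈ W, x ∈ 𝓑.doc ↔ F x < 0) ∧ ∀ x ∈ W ∩ 𝓑.horizon, ∃ c : ℝ, c ≠ 0 ∧ ∀ w : TangentSpace (𝓡 4) x, mfderiv (𝓡 4) 𝓘(ℝ, ℝ) F x w = c * 𝓑.metric.val x (K x) w := by
  intro 𝓑 U K hU hHU hK hKne hnull htan p hp
  -- ## the past set, its complement, the horizon
  set Pst : Set 𝓑.carrier := 𝓑.metric.chronologicalPast 𝓑.timeOrientation 𝓑.Mext with hPst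
  set Fut : Set 𝓑.carrier := 𝓑.metric.chronologicalFuture 𝓑.timeOrientation 𝓑.Mext with hFut
  set S : Set 𝓑.carrier := Pstᶜ with hSdef
  have hPopen : IsOpen Pst := hrPrep_isOpen_past 𝓑
  have hFopen : IsOpen Fut := hrPrep_isOpen_future 𝓑
  have hSfut : 𝓑.metric.IsFutureSet 𝓑.timeOrientation S := hrPrep_isFutureSet_compl_past 𝓑
  have hfrS : frontier S = frontier Pst := frontier_compl Pst
  have hintSc : interior Sᶜ = Pst := hrPrep_interior_compl_compl 𝓑
  have hhor : ∀ x : 𝓑.carrier, x ∈ 𝓑.horizon ↔ x ∈ frontier S ∧ x ∈ Fut := hrPrep_mem_horizon_iff 𝓑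
  obtain ⟨hpS, hpF⟩ := (hhor p).mp hp
  have hpU : p ∈ U := hHU hp
  -- ## the chart at `p`, the timelike direction `v`, the cone radius (shrunk into `U ∩ I⁺`)
  obtain ⟨v, hv0, ρ₀, hρ₀0, hρ₀⟩ := exists_ball_subset_chartCone 𝓑.metric 𝓑.timeOrientation p
  obtain ⟨ρ₁, hρ₁0, hρ₁⟩ : ∃ ρ₁ > 0, ∀ z : E4, ‖z - (extChartAt (𝓡 4) p p)‖ < ρ₁ →
      z ∈ (extChartAt (𝓡 4) p).target ∧ (extChartAt (𝓡 4) p).symm z ∈ U ∧ (extChartAt (𝓡 4) p).symm z ∈ Fut := by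
    have hT : IsOpen ((extChartAt (𝓡 4) p).target ∩ (extChartAt (𝓡 4) p).symm ⁻¹' (U ∩ Fut)) :=
      (continuousOn_extChartAt_symm p).isOpen_inter_preimage (isOpen_extChartAt_target p)
        (hU.inter hFopen)
    have hz₀T : (extChartAt (𝓡 4) p p) ∈ (extChartAt (𝓡 4) p).target ∩ (extChartAt (𝓡 4) p).symm ⁻¹' (U ∩ Fut) := by
      refine ⟨mem_extChartAt_target p, ?_⟩
      show (extChartAt (𝓡 4) p).symm (extChartAt (𝓡 4) p p) ∈ U ∩ Fut
      rw [extChartAt_to_inv]; exact ⟨hpU, hpF⟩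
    obtain ⟨ρ₁, hρ₁0, hball⟩ := Metric.isOpen_iff.mp hT (extChartAt (𝓡 4) p p) hz₀T
    refine ⟨ρ₁, hρ₁0, fun z hz ↦ ?_⟩
    have h := hball (mem_ball_iff_norm.mpr hz)
    exact ⟨h.1, h.2.1, h.2.2⟩
  set ρ : ℝ := min ρ₀ ρ₁ with hρdef
  have hρ0 : 0 < ρ := lt_min hρ₀0 hρ₁0
  have hρ : ∀ z u : E4, ‖z - (extChartAt (𝓡 4) p) p‖ < ρ → ‖u - v‖ < ρ →
      (z, u) ∈ chartCone 𝓑.metric 𝓑.timeOrientation p := fun z u hz hu ↦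
    hρ₀ z u (hz.trans_le (min_le_left _ _)) (hu.trans_le (min_le_left _ _))
  have hρU : ∀ z : E4, ‖z - (extChartAt (𝓡 4) p p)‖ < ρ → z ∈ (extChartAt (𝓡 4) p).target ∧ (extChartAt (𝓡 4) p).symm z ∈ U ∧ (extChartAt (𝓡 4) p).symm z ∈ Fut :=
    fun z hz ↦ hρ₁ z (hz.trans_le (min_le_right _ _))
  -- ## the lines and the height (Hawking–Ellis' box)
  set δ : ℝ := ρ / (2 * (‖v‖ + 1)) with hδdef
  have hδ : 0 < δ := by positivity
  have hδv : δ * ‖v‖ ≤ ρ / 2 := by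
    rw [hδdef, div_mul_eq_mul_div, div_le_div_iff₀ (by positivity) (by norm_num)]
    nlinarith [norm_nonneg v]
  obtain ⟨P, hP⟩ : ∃ P : E4 → ℝ → 𝓑.carrier, ∀ y t, P y t = (extChartAt (𝓡 4) p).symm ((extChartAt (𝓡 4) p p) + y + t • v) :=
    ⟨_, fun _ _ ↦ rfl⟩
  have hq0 : P 0 0 = p := by
    rw [hP, add_zero, zero_smul, add_zero, extChartAt_to_inv]
  have h0I : (0 : ℝ) ∈ Icc (-δ) δ := ⟨by linarith, hδ.le⟩
  have hδI : δ ∈ Icc (-δ) δ := ⟨by linarith, le_rfl⟩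
  have hnδI : -δ ∈ Icc (-δ) δ := ⟨le_rfl, by linarith⟩
  have hy0 : ‖(0 : E4)‖ < ρ / 2 := by simpa using hρ0
  have htop0 : P 0 δ ∈ interior S := by
    have h := linePoint_mem_chronologicalFuture hP hρ hδv hy0 h0I hδI hδ
    rw [hq0] at h
    exact hSfut.chronologicalFuture_subset_interior (frontier_subset_closure hpS) h
  have hbot0 : P 0 (-δ) ∈ interior Sᶜ := by
    have h := linePoint_mem_chronologicalFuture hP hρ hδv hy0 hnδI h0I (by linarith)
    rw [hq0] at h
    have hq' : p ∈ closure Sᶜ := by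
      rw [← frontier_compl] at hpS
      exact frontier_subset_closure hpS
    exact IsFutureSet.chronologicalFuture_subset_interior (τ := 𝓑.timeOrientation.reverse)
      hSfut.isPastSet_compl hq' (mem_chronologicalPast_of_mem_chronologicalFuture h)
  have hevtop : ∀ᶠ y in 𝓝 (0 : E4), P y δ ∈ interior S :=
    (continuousAt_linePoint_left hP hρ hδv hy0 hδI).preimage_mem_nhds
      (isOpen_interior.mem_nhds htop0)
  have hevbot : ∀ᶠ y in 𝓝 (0 : E4), P y (-δ) ∈ interior Sᶜ :=
    (continuousAt_linePoint_left hP hρ hδv hy0 hnδI).preimage_mem_nhds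
      (isOpen_interior.mem_nhds hbot0)
  obtain ⟨ε₁, hε₁, hball⟩ := Metric.eventually_nhds_iff.mp (hevtop.and hevbot)
  set ε : ℝ := min ε₁ (ρ / 2) with hεdef
  have hε0 : 0 < ε := lt_min hε₁ (by positivity)
  have hε : ε ≤ ρ / 2 := min_le_right _ _
  have htop : ∀ y : E4, ‖y‖ < ε → P y δ ∈ interior S := fun y hy ↦
    (hball (y := y) (by simpa using hy.trans_le (min_le_left _ _))).1
  have hbot : ∀ y : E4, ‖y‖ < ε → P y (-δ) ∈ interior Sᶜ := fun y hy ↦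
    (hball (y := y) (by simpa using hy.trans_le (min_le_left _ _))).2
  obtain ⟨A, B, ℓ, hBA, hAB, hℓB, hAv, hℓv⟩ := exists_lineSplitting hv0
  set hgt : E3 → ℝ := fun y ↦ sInf {t : ℝ | t ∈ Icc (-δ) δ ∧ P (B y) t ∈ S} with hhgt
  set D : Set E3 := {y | ‖B y‖ < ε} with hDdef
  have hDo : IsOpen D := isOpen_lt (continuous_norm.comp B.continuous) continuous_const
  set Box : Set E4 := {z | ‖B (A (z - (extChartAt (𝓡 4) p p)))‖ < ε ∧ ℓ (z - (extChartAt (𝓡 4) p p)) ∈ Ioo (-δ) δ} with hBoxdef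
  have hBoxo : IsOpen Box :=
    (isOpen_lt (continuous_norm.comp (B.continuous.comp (A.continuous.comp
      (continuous_sub_right (extChartAt (𝓡 4) p p))))) continuous_const).and
      (isOpen_Ioo.preimage (ℓ.continuous.comp (continuous_sub_right (extChartAt (𝓡 4) p p))))
  set W : Set 𝓑.carrier := (extChartAt (𝓡 4) p).source ∩ (extChartAt (𝓡 4) p) ⁻¹' Box with hWdef
  have hWo : IsOpen W := isOpen_extChartAt_preimage' p hBoxo
  have key : ∀ y : E3, y ∈ D → ∀ t ∈ Icc (-δ) δ,
      P (B y) t ∈ (extChartAt (𝓡 4) p).source ∧ (extChartAt (𝓡 4) p) (P (B y) t) = (extChartAt (𝓡 4) p p) + B y + t • v := fun y hy t ht ↦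
    extChartAt_linePoint hP hρ hδv (hy.trans_le hε) ht
  have hginv : ∀ y : E3, y ∈ D → hgt y ∈ Ioo (-δ) δ := fun y hy ↦
    ⟨neg_lt_lineHeight hP hρ hδv (hy.trans_le hε) hδ (interior_subset (htop _ hy)) (hbot _ hy),
      lineHeight_lt hP hρ hδv (hy.trans_le hε) hδ (htop _ hy)⟩
  have hWbox : ∀ x ∈ W, ‖(extChartAt (𝓡 4) p) x - (extChartAt (𝓡 4) p p)‖ < ρ := by
    intro x hx
    have hxB : ‖B (A ((extChartAt (𝓡 4) p) x - (extChartAt (𝓡 4) p p)))‖ < ε ∧ ℓ ((extChartAt (𝓡 4) p) x - (extChartAt (𝓡 4) p p)) ∈ Ioo (-δ) δ := hx.2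
    exact hrPrep_norm_lt_of_box (hBA _) hxB.1 (abs_lt.mpr hxB.2) hε hδv
  have hWU : ∀ x ∈ W, x ∈ U ∧ x ∈ Fut := by
    intro x hx
    have h := hρU ((extChartAt (𝓡 4) p) x) (hWbox x hx)
    rw [(extChartAt (𝓡 4) p).left_inv hx.1] at h
    exact ⟨h.2.1, h.2.2⟩
  have hinvW : ∀ y : E3, y ∈ D → P (B y) (hgt y) ∈ W := by
    intro y hy
    obtain ⟨hsrc, hval⟩ := key y hy (hgt y) (Ioo_subset_Icc_self (hginv y hy))
    refine ⟨hsrc, ?_⟩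
    show (extChartAt (𝓡 4) p) (P (B y) (hgt y)) ∈ Box
    rw [hval]
    have e1 : (extChartAt (𝓡 4) p p) + B y + hgt y • v - (extChartAt (𝓡 4) p p) = B y + hgt y • v := by abel
    refine ⟨?_, ?_⟩
    · rw [e1, map_add, map_smul, hAB, hAv, smul_zero, add_zero]; exact hy
    · rw [e1, map_add, map_smul, hℓB, hℓv, zero_add, smul_eq_mul, mul_one]; exact hginv y hy
  have hinvF : ∀ y : E3, y ∈ D → P (B y) (hgt y) ∈ frontier S := fun y hy ↦
    linePoint_lineHeight_mem_frontier hP hρ hδv hSfut (hy.trans_le hε) hδ (htop _ hy) (hbot _ hy)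
  have hinvH : ∀ y : E3, y ∈ D → P (B y) (hgt y) ∈ 𝓑.horizon := fun y hy ↦
    (hhor _).mpr ⟨hinvF y hy, (hWU _ (hinvW y hy)).2⟩
  have hxline : ∀ x ∈ W, P (B (A ((extChartAt (𝓡 4) p) x - (extChartAt (𝓡 4) p p)))) (ℓ ((extChartAt (𝓡 4) p) x - (extChartAt (𝓡 4) p p))) = x := by
    intro x hx
    rw [hP, add_assoc, hBA, add_sub_cancel, (extChartAt (𝓡 4) p).left_inv hx.1]
  have hyD : ∀ x ∈ W, A ((extChartAt (𝓡 4) p) x - (extChartAt (𝓡 4) p p)) ∈ D := fun x hx ↦ (show (extChartAt (𝓡 4) p) x ∈ Box from hx.2).1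
  have htI : ∀ x ∈ W, ℓ ((extChartAt (𝓡 4) p) x - (extChartAt (𝓡 4) p p)) ∈ Ioo (-δ) δ := fun x hx ↦ (show (extChartAt (𝓡 4) p) x ∈ Box from hx.2).2
  have hsurj : ∀ x ∈ W, x ∈ frontier S → ℓ ((extChartAt (𝓡 4) p) x - (extChartAt (𝓡 4) p p)) = hgt (A ((extChartAt (𝓡 4) p) x - (extChartAt (𝓡 4) p p))) := by
    intro x hx hxF
    exact eq_lineHeight_of_mem_frontier hP hρ hδv hSfut ((hyD x hx).trans_le hε) hδ
      (interior_subset (htop _ (hyD x hx))) (Ioo_subset_Icc_self (htI x hx))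
      ((hxline x hx).symm ▸ hxF)
  have hcont : ContinuousOn hgt D := fun y hy ↦
    ((continuousAt_lineHeight hP hρ hδv hSfut hε hδ htop hbot hy).comp
      B.continuous.continuousAt).continuousWithinAt
  -- ## bricks G, S, D: the slope field and the derivative of the height
  obtain ⟨Gf, hGf⟩ : ∃ Gf : E3 × ℝ → E3 →L[ℝ] ℝ, ∀ w : E3 × ℝ, Gf w =
      -(((𝓑.metric.val ((extChartAt (𝓡 4) p).symm ((extChartAt (𝓡 4) p p) + B w.1 + w.2 • v)) (K ((extChartAt (𝓡 4) p).symm ((extChartAt (𝓡 4) p p) + B w.1 + w.2 • v)))).comp ((trivializationAt E4 (TangentSpace (𝓡 4)) p).symmL ℝ ((extChartAt (𝓡 4) p).symm ((extChartAt (𝓡 4) p p) + B w.1 + w.2 • v)))) v)⁻¹ •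
        (((𝓑.metric.val ((extChartAt (𝓡 4) p).symm ((extChartAt (𝓡 4) p p) + B w.1 + w.2 • v)) (K ((extChartAt (𝓡 4) p).symm ((extChartAt (𝓡 4) p p) + B w.1 + w.2 • v)))).comp ((trivializationAt E4 (TangentSpace (𝓡 4)) p).symmL ℝ ((extChartAt (𝓡 4) p).symm ((extChartAt (𝓡 4) p p) + B w.1 + w.2 • v)))).comp B) :=
    ⟨_, fun _ ↦ rfl⟩
  obtain ⟨Ω, hΩ⟩ : ∃ Ω : Set (E3 × ℝ), Ω = {w : E3 × ℝ | ((extChartAt (𝓡 4) p p) + B w.1 + w.2 • v ∈ (extChartAt (𝓡 4) p).target ∧ ((extChartAt (𝓡 4) p).symm ((extChartAt (𝓡 4) p p) + B w.1 + w.2 • v)) ∈ U) ∧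
      𝓑.metric.val ((extChartAt (𝓡 4) p).symm ((extChartAt (𝓡 4) p p) + B w.1 + w.2 • v)) ((trivializationAt E4 (TangentSpace (𝓡 4)) p).symmL ℝ ((extChartAt (𝓡 4) p).symm ((extChartAt (𝓡 4) p p) + B w.1 + w.2 • v)) v) (K ((extChartAt (𝓡 4) p).symm ((extChartAt (𝓡 4) p p) + B w.1 + w.2 • v))) ≠ 0} :=
    ⟨_, rfl⟩
  obtain ⟨hΩo, hGs⟩ : IsOpen Ω ∧ ContDiffOn ℝ ∞ Gf Ω := by
    obtain ⟨h1, h2⟩ := hG 𝓑 U K p B (extChartAt (𝓡 4) p p) v hU hK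
    rw [hΩ]
    refine ⟨h1, h2.congr fun w _ ↦ ?_⟩
    rw [hGf w]
    ext h
    simp only [FunLike.coe_smul, Pi.smul_apply, smul_eq_mul, ContinuousLinearMap.comp_apply]
    rw [𝓑.metric.symm _ (K _) ((trivializationAt E4 (TangentSpace (𝓡 4)) p).symmL ℝ _ v)]
  -- `e⁻¹ v` is timelike at the points of `W`, so `g(e⁻¹ v, K) ≠ 0` at its horizon points
  have hev_tl : ∀ x : 𝓑.carrier, x ∈ W → 𝓑.metric.val x ((trivializationAt E4 (TangentSpace (𝓡 4)) p).symmL ℝ x v) ((trivializationAt E4 (TangentSpace (𝓡 4)) p).symmL ℝ x v) < 0 := by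
    intro x hx
    have h := hρ ((extChartAt (𝓡 4) p) x) v (hWbox x hx) (by simpa using hρ0)
    rw [mem_chartCone_iff] at h
    have h2 : 𝓑.metric.IsTimelike ((trivializationAt E4 (TangentSpace (𝓡 4)) p).symmL ℝ ((extChartAt (𝓡 4) p).symm ((extChartAt (𝓡 4) p) x)) v) := h.2.1
    rw [(extChartAt (𝓡 4) p).left_inv hx.1] at h2
    exact h2
  have hden : ∀ x : 𝓑.carrier, x ∈ W → x ∈ 𝓑.horizon → 𝓑.metric.val x ((trivializationAt E4 (TangentSpace (𝓡 4)) p).symmL ℝ x v) (K x) ≠ 0 :=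
    fun x hx hxH ↦ 𝓑.metric.val_ne_zero_of_isTimelike_of_isCausal (hev_tl x hx)
      ⟨le_of_eq (hnull x hxH), hKne x hxH⟩
  have hgrW : ∀ y ∈ D, ((extChartAt (𝓡 4) p).symm ((extChartAt (𝓡 4) p p) + B y + hgt y • v)) ∈ W := fun y hy ↦ by
    rw [← hP]; exact hinvW y hy
  have hgrH : ∀ y ∈ D, ((extChartAt (𝓡 4) p).symm ((extChartAt (𝓡 4) p p) + B y + hgt y • v)) ∈ 𝓑.horizon := fun y hy ↦ by
    rw [← hP]; exact hinvH y hy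
  have hgrkey : ∀ y ∈ D, ((extChartAt (𝓡 4) p).symm ((extChartAt (𝓡 4) p p) + B y + hgt y • v)) ∈ (extChartAt (𝓡 4) p).source ∧
      (extChartAt (𝓡 4) p) ((extChartAt (𝓡 4) p).symm ((extChartAt (𝓡 4) p p) + B y + hgt y • v)) = (extChartAt (𝓡 4) p p) + B y + hgt y • v := fun y hy ↦ by
    rw [← hP]; exact key y hy (hgt y) (Ioo_subset_Icc_self (hginv y hy))
  -- the derivative of the height at every point of `D` (bricks S and D)
  have hderiv : ∀ y₁ ∈ D, HasFDerivAt hgt (Gf (y₁, hgt y₁)) y₁ := by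
    intro y₁ hy₁
    have hx₁W := hgrW y₁ hy₁
    have hx₁H := hgrH y₁ hy₁
    obtain ⟨hx₁src, hx₁val⟩ := hgrkey y₁ hy₁
    have hx₁c : ((extChartAt (𝓡 4) p).symm ((extChartAt (𝓡 4) p p) + B y₁ + hgt y₁ • v)) ∈ (chartAt E4 p).source := by
      rw [← extChartAt_source (𝓡 4)]; exact hx₁src
    -- future-directed null data and the sandwich at the graph point
    obtain ⟨ε₂, hε₂, γ, hγ0, hγint, hγhor⟩ := htan _ hx₁H
    obtain ⟨L, γ', hL, hLnull, hLfut, hγ'0, hγ'd, hγ'hor⟩ :=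
      hrPrep_exists_futureNull_curve (hKne _ hx₁H) (hnull _ hx₁H) hε₂ hγ0 hγint hγhor
    have hγ'fr : ∀ t ∈ Ioo (-ε₂) ε₂, γ' t ∈ frontier Pst := fun t ht ↦ by
      have h := ((hhor _).mp (hγ'hor t ht)).1
      rwa [hfrS] at h
    have hsandS := hS 𝓑 p ((extChartAt (𝓡 4) p).symm ((extChartAt (𝓡 4) p p) + B y₁ + hgt y₁ • v)) L γ' ε₂ hx₁c hε₂ hγ'0 hγ'd hLnull hLfut hγ'fr
    -- the functional `Λ u = g(e⁻¹ u, L)`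
    obtain ⟨Λ, hΛapply⟩ : ∃ Λ : E4 →L[ℝ] ℝ, ∀ u : E4, Λ u = 𝓑.metric.val ((extChartAt (𝓡 4) p).symm ((extChartAt (𝓡 4) p p) + B y₁ + hgt y₁ • v)) ((trivializationAt E4 (TangentSpace (𝓡 4)) p).symmL ℝ ((extChartAt (𝓡 4) p).symm ((extChartAt (𝓡 4) p p) + B y₁ + hgt y₁ • v)) u) L :=
      ⟨(𝓑.metric.val ((extChartAt (𝓡 4) p).symm ((extChartAt (𝓡 4) p p) + B y₁ + hgt y₁ • v)) L).comp ((trivializationAt E4 (TangentSpace (𝓡 4)) p).symmL ℝ ((extChartAt (𝓡 4) p).symm ((extChartAt (𝓡 4) p p) + B y₁ + hgt y₁ • v))), fun u ↦ by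
        rw [ContinuousLinearMap.comp_apply]; exact 𝓑.metric.symm _ _ _⟩
    have hLne : L ≠ 0 := by
      rcases hL with rfl | rfl
      · exact hKne _ hx₁H
      · exact neg_ne_zero.mpr (hKne _ hx₁H)
    have hΛv : Λ v ≠ 0 := by
      rw [hΛapply]
      exact 𝓑.metric.val_ne_zero_of_isTimelike_of_isCausal (hev_tl _ hx₁W) ⟨le_of_eq hLnull, hLne⟩
    have hsand' : ∀ μ : ℝ, 0 < μ → ∀ᶠ z in 𝓝 ((extChartAt (𝓡 4) p p) + B y₁ + hgt y₁ • v),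
        (extChartAt (𝓡 4) p).symm z ∈ frontier S → |Λ (z - ((extChartAt (𝓡 4) p p) + B y₁ + hgt y₁ • v))| ≤
          μ * ‖z - ((extChartAt (𝓡 4) p p) + B y₁ + hgt y₁ • v)‖ := by
      intro μ hμ
      have h := hsandS μ hμ
      rw [hx₁val] at h
      filter_upwards [h] with z hz hzS
      rw [hfrS] at hzS
      rw [hΛapply]
      exact hz hzS
    have hD' := hD 𝓑 p v ρ δ ε P S B y₁ Λ hP hρ hδv hSfut hε hδ htop hbot hy₁ hΛv hsand'
    -- identify `−(Λ v)⁻¹ Λ ∘ B` with the slope field at the graph point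
    have hGΛ : Gf (y₁, hgt y₁) = -(Λ v)⁻¹ • (Λ.comp B) := by
      rw [hGf (y₁, hgt y₁)]
      ext h
      simp only [FunLike.coe_smul, Pi.smul_apply, smul_eq_mul, ContinuousLinearMap.comp_apply]
      rw [hΛapply, hΛapply]
      rcases hL with hL' | hL'
      · rw [hL', 𝓑.metric.symm _ (K _) ((trivializationAt E4 (TangentSpace (𝓡 4)) p).symmL ℝ _ v), 𝓑.metric.symm _ (K _) ((trivializationAt E4 (TangentSpace (𝓡 4)) p).symmL ℝ _ (B h))]
      · rw [hL', map_neg, map_neg, 𝓑.metric.symm _ (K _) ((trivializationAt E4 (TangentSpace (𝓡 4)) p).symmL ℝ _ v),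
          𝓑.metric.symm _ (K _) ((trivializationAt E4 (TangentSpace (𝓡 4)) p).symmL ℝ _ (B h)), inv_neg]
        ring
    rw [hGΛ]
    exact hD'
  -- ## brick B: the height is smooth
  have hgraph : ∀ y ∈ D, (y, hgt y) ∈ Ω := fun y hy ↦ by
    rw [hΩ]
    exact ⟨⟨linePoint_mem_target hρ hδv (hy.trans_le hε) (Ioo_subset_Icc_self (hginv y hy)),
      (hWU _ (hgrW y hy)).1⟩, hden _ (hgrW y hy) (hgrH y hy)⟩
  have hsmooth : ContDiffOn ℝ ∞ hgt D := hB hgt Gf D Ω hDo hΩo hcont hgraph hGs hderiv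
  -- ## the defining function `F = ℓ(φ − φ p) − u(A(φ − φ p))` and its derivative along the horizon
  obtain ⟨Fh, hFhapply⟩ : ∃ Fh : E4 → ℝ, ∀ z, Fh z = ℓ (z - (extChartAt (𝓡 4) p p)) - hgt (A (z - (extChartAt (𝓡 4) p p))) :=
    ⟨_, fun _ ↦ rfl⟩
  have hmain : ∀ y₁ ∈ D, ∃ c : ℝ, c ≠ 0 ∧ ∀ w : TangentSpace (𝓡 4) ((extChartAt (𝓡 4) p).symm ((extChartAt (𝓡 4) p p) + B y₁ + hgt y₁ • v)),
      mfderiv (𝓡 4) 𝓘(ℝ, ℝ) (Fh ∘ (extChartAt (𝓡 4) p)) ((extChartAt (𝓡 4) p).symm ((extChartAt (𝓡 4) p p) + B y₁ + hgt y₁ • v)) w = c * 𝓑.metric.val ((extChartAt (𝓡 4) p).symm ((extChartAt (𝓡 4) p p) + B y₁ + hgt y₁ • v)) (K ((extChartAt (𝓡 4) p).symm ((extChartAt (𝓡 4) p p) + B y₁ + hgt y₁ • v))) w := by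
    intro y₁ hy₁
    obtain ⟨hx₁src, hx₁val⟩ := hgrkey y₁ hy₁
    have hx₁c : ((extChartAt (𝓡 4) p).symm ((extChartAt (𝓡 4) p p) + B y₁ + hgt y₁ • v)) ∈ (chartAt E4 p).source := by
      rw [← extChartAt_source (𝓡 4)]; exact hx₁src
    obtain ⟨Λ, hΛ⟩ : ∃ Λ : E4 →L[ℝ] ℝ, ∀ u : E4, Λ u = 𝓑.metric.val ((extChartAt (𝓡 4) p).symm ((extChartAt (𝓡 4) p p) + B y₁ + hgt y₁ • v)) (K ((extChartAt (𝓡 4) p).symm ((extChartAt (𝓡 4) p p) + B y₁ + hgt y₁ • v))) ((trivializationAt E4 (TangentSpace (𝓡 4)) p).symmL ℝ ((extChartAt (𝓡 4) p).symm ((extChartAt (𝓡 4) p p) + B y₁ + hgt y₁ • v)) u) :=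
      ⟨(𝓑.metric.val ((extChartAt (𝓡 4) p).symm ((extChartAt (𝓡 4) p p) + B y₁ + hgt y₁ • v)) (K ((extChartAt (𝓡 4) p).symm ((extChartAt (𝓡 4) p p) + B y₁ + hgt y₁ • v)))).comp ((trivializationAt E4 (TangentSpace (𝓡 4)) p).symmL ℝ ((extChartAt (𝓡 4) p).symm ((extChartAt (𝓡 4) p p) + B y₁ + hgt y₁ • v))), fun u ↦ by
        rw [ContinuousLinearMap.comp_apply]⟩
    have hΛv : Λ v ≠ 0 := by
      rw [hΛ, 𝓑.metric.symm]
      exact hden _ (hgrW y₁ hy₁) (hgrH y₁ hy₁)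
    have hdg : HasFDerivAt hgt (-(Λ v)⁻¹ • (Λ.comp B)) y₁ := by
      have h := hderiv y₁ hy₁
      have hGΛ : Gf (y₁, hgt y₁) = -(Λ v)⁻¹ • (Λ.comp B) := by
        rw [hGf (y₁, hgt y₁)]
        ext h'
        simp only [FunLike.coe_smul, Pi.smul_apply, smul_eq_mul, ContinuousLinearMap.comp_apply]
        rw [hΛ, hΛ]
      rwa [hGΛ] at h
    -- `A (φ x₁ − φ p) = y₁`
    have hAφ : A ((extChartAt (𝓡 4) p) ((extChartAt (𝓡 4) p).symm ((extChartAt (𝓡 4) p p) + B y₁ + hgt y₁ • v)) - (extChartAt (𝓡 4) p p)) = y₁ := by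
      rw [hx₁val, show (extChartAt (𝓡 4) p p) + B y₁ + hgt y₁ • v - (extChartAt (𝓡 4) p p) = B y₁ + hgt y₁ • v by abel, map_add,
        map_smul, hAB, hAv, smul_zero, add_zero]
    -- the derivative of `Fh` at `φ x₁`
    have hsub : HasFDerivAt (fun z : E4 ↦ z - (extChartAt (𝓡 4) p p)) (ContinuousLinearMap.id ℝ E4) ((extChartAt (𝓡 4) p) ((extChartAt (𝓡 4) p).symm ((extChartAt (𝓡 4) p p) + B y₁ + hgt y₁ • v))) :=
      (hasFDerivAt_id _).sub_const (extChartAt (𝓡 4) p p)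
    have h1 : HasFDerivAt (fun z : E4 ↦ ℓ (z - (extChartAt (𝓡 4) p p))) ℓ ((extChartAt (𝓡 4) p) ((extChartAt (𝓡 4) p).symm ((extChartAt (𝓡 4) p p) + B y₁ + hgt y₁ • v))) := by
      have h := ℓ.hasFDerivAt.comp _ hsub
      rwa [ContinuousLinearMap.comp_id] at h
    have hA' : HasFDerivAt (fun z : E4 ↦ A (z - (extChartAt (𝓡 4) p p))) A ((extChartAt (𝓡 4) p) ((extChartAt (𝓡 4) p).symm ((extChartAt (𝓡 4) p p) + B y₁ + hgt y₁ • v))) := by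
      have h := A.hasFDerivAt.comp _ hsub
      rwa [ContinuousLinearMap.comp_id] at h
    have h2 : HasFDerivAt (fun z : E4 ↦ hgt (A (z - (extChartAt (𝓡 4) p p)))) ((-(Λ v)⁻¹ • (Λ.comp B)).comp A)
        ((extChartAt (𝓡 4) p) ((extChartAt (𝓡 4) p).symm ((extChartAt (𝓡 4) p p) + B y₁ + hgt y₁ • v))) := by
      rw [← hAφ] at hdg
      exact hdg.comp ((extChartAt (𝓡 4) p) ((extChartAt (𝓡 4) p).symm ((extChartAt (𝓡 4) p p) + B y₁ + hgt y₁ • v))) hA'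
    have hFh' : HasFDerivAt Fh (ℓ - (-(Λ v)⁻¹ • (Λ.comp B)).comp A) ((extChartAt (𝓡 4) p) ((extChartAt (𝓡 4) p).symm ((extChartAt (𝓡 4) p p) + B y₁ + hgt y₁ • v))) :=
      (h1.sub h2).congr_of_eventuallyEq (Eventually.of_forall fun z ↦ hFhapply z)
    obtain ⟨M, hM⟩ : ∃ M : TangentSpace (𝓡 4) ((extChartAt (𝓡 4) p).symm ((extChartAt (𝓡 4) p p) + B y₁ + hgt y₁ • v)) →L[ℝ] E4,
        HasMFDerivAt (𝓡 4) 𝓘(ℝ, E4) (extChartAt (𝓡 4) p) ((extChartAt (𝓡 4) p).symm ((extChartAt (𝓡 4) p p) + B y₁ + hgt y₁ • v)) M := ⟨_, hasMFDerivAt_extChartAt hx₁c⟩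
    have hFd := hFh'.hasMFDerivAt.comp ((extChartAt (𝓡 4) p).symm ((extChartAt (𝓡 4) p p) + B y₁ + hgt y₁ • v)) hM
    have hbase : ((extChartAt (𝓡 4) p).symm ((extChartAt (𝓡 4) p p) + B y₁ + hgt y₁ • v)) ∈ (trivializationAt E4 (TangentSpace (𝓡 4)) p).baseSet := by
      rw [TangentBundle.trivializationAt_baseSet]; exact hx₁c
    have hcl : (trivializationAt E4 (TangentSpace (𝓡 4)) p).continuousLinearMapAt ℝ ((extChartAt (𝓡 4) p).symm ((extChartAt (𝓡 4) p p) + B y₁ + hgt y₁ • v)) = M := by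
      rw [TangentBundle.continuousLinearMapAt_trivializationAt hx₁c, hM.mfderiv]
    refine ⟨(Λ v)⁻¹, inv_ne_zero hΛv, fun w ↦ ?_⟩
    rw [hFd.mfderiv]
    change ℓ (M w) - (-(Λ v)⁻¹ • (Λ.comp B)) (A (M w)) = _
    rw [hrPrep_deriv_formula hBA hΛv]
    congr 1
    rw [hΛ, ← hcl, (trivializationAt E4 (TangentSpace (𝓡 4)) p).symmL_continuousLinearMapAt hbase]
  -- ## conclusion
  refine ⟨W, hWo, ⟨mem_extChartAt_source p, ?_⟩, fun x hx ↦ (hWU x hx).1, Fh ∘ (extChartAt (𝓡 4) p), ?_, ?_, ?_, ?_⟩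
  · -- `p ∈ W`
    show (extChartAt (𝓡 4) p) p ∈ Box
    refine ⟨?_, ?_⟩
    · rw [sub_self, map_zero, map_zero, norm_zero]; exact hε0
    · rw [sub_self, map_zero]; exact ⟨by linarith, hδ⟩
  · -- smoothness of `F`
    have haffA : ContDiff ℝ ∞ (fun z : E4 ↦ A (z - (extChartAt (𝓡 4) p p))) := A.contDiff.comp (contDiff_id.sub contDiff_const)
    have hFh_s : ContDiffOn ℝ ∞ Fh {z : E4 | A (z - (extChartAt (𝓡 4) p p)) ∈ D} :=
      ((ℓ.contDiff.comp (contDiff_id.sub contDiff_const)).contDiffOn.sub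
        (hsmooth.comp haffA.contDiffOn fun z hz ↦ hz)).congr fun z _ ↦ hFhapply z
    have h1 : ContMDiffOn 𝓘(ℝ, E4) 𝓘(ℝ, ℝ) ∞ Fh {z : E4 | A (z - (extChartAt (𝓡 4) p p)) ∈ D} :=
      contMDiffOn_iff_contDiffOn.mpr hFh_s
    have h2 : ContMDiffOn (𝓡 4) 𝓘(ℝ, E4) ∞ (extChartAt (𝓡 4) p) W :=
      (contMDiffOn_extChartAt (x := p)).mono fun x hx ↦ by
        rw [← extChartAt_source (𝓡 4)]; exact hx.1
    exact h1.comp h2 fun x hx ↦ hyD x hx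
  · -- `𝓔⁺ ∩ W = {F = 0}`
    intro x hx
    show x ∈ 𝓑.horizon ↔ Fh ((extChartAt (𝓡 4) p) x) = 0
    rw [hFhapply]
    constructor
    · intro hxH
      have hxF : x ∈ frontier S := ((hhor x).mp hxH).1
      rw [hsurj x hx hxF, sub_self]
    · intro h0
      have h0' : ℓ ((extChartAt (𝓡 4) p) x - (extChartAt (𝓡 4) p p)) = hgt (A ((extChartAt (𝓡 4) p) x - (extChartAt (𝓡 4) p p))) := sub_eq_zero.mp h0
      have hx' : P (B (A ((extChartAt (𝓡 4) p) x - (extChartAt (𝓡 4) p p)))) (hgt (A ((extChartAt (𝓡 4) p) x - (extChartAt (𝓡 4) p p)))) = x := by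
        rw [← h0']; exact hxline x hx
      rw [← hx']
      exact hinvH _ (hyD x hx)
  · -- `⟨⟨M_ext⟩⟩ ∩ W = {F < 0}`
    intro x hx
    have hxdoc : x ∈ 𝓑.doc ↔ x ∈ Pst := ⟨fun h ↦ h.2, fun h ↦ ⟨(hWU x hx).2, h⟩⟩
    rw [hxdoc]
    show x ∈ Pst ↔ Fh ((extChartAt (𝓡 4) p) x) < 0
    rw [hFhapply]
    rcases lt_trichotomy (ℓ ((extChartAt (𝓡 4) p) x - (extChartAt (𝓡 4) p p))) (hgt (A ((extChartAt (𝓡 4) p) x - (extChartAt (𝓡 4) p p)))) with hlt | heq | hgt'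
    · refine ⟨fun _ ↦ by linarith, fun _ ↦ ?_⟩
      have h := linePoint_mem_interior_compl_of_lt_lineHeight hP hρ hδv hSfut ((hyD x hx).trans_le hε)
        hδ (interior_subset (htop _ (hyD x hx))) (htI x hx).1.le hlt
      rw [hxline x hx, hintSc] at h
      exact h
    · refine ⟨fun hxP ↦ ?_, fun h ↦ absurd h (by linarith)⟩
      exfalso
      have hxfr : x ∈ frontier S := by
        rw [← hxline x hx, heq]; exact hinvF _ (hyD x hx)
      rw [hfrS] at hxfr
      exact hrPrep_not_mem_frontier_of_mem_past 𝓑 hxP hxfr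
    · refine ⟨fun hxP ↦ ?_, fun h ↦ absurd h (by linarith)⟩
      exfalso
      have h := linePoint_mem_interior_of_lineHeight_lt hP hρ hδv hSfut ((hyD x hx).trans_le hε) hδ
        (interior_subset (htop _ (hyD x hx))) hgt' (htI x hx).2.le
      rw [hxline x hx] at h
      exact hrPrep_not_mem_past_of_mem_interior_compl 𝓑 h hxP
  · -- `dF = c g(K, ·)` along the horizon
    rintro x ⟨hxW, hxH⟩
    have hxF : x ∈ frontier S := ((hhor x).mp hxH).1
    have hxeq : ((extChartAt (𝓡 4) p).symm ((extChartAt (𝓡 4) p p) + B (A ((extChartAt (𝓡 4) p) x - (extChartAt (𝓡 4) p p))) + hgt (A ((extChartAt (𝓡 4) p) x - (extChartAt (𝓡 4) p p))) • v)) = x := by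
      rw [← hP, ← hsurj x hxW hxF]; exact hxline x hxW
    have h := hmain _ (hyD x hxW)
    rw [hxeq] at h
    exact h

/-- **Registered form of the HR assembly** (closed statement, crux stmt-FinalStateConjecture-17840):
the local defining functions of the horizon, from the LANDED bricks `stub_hr_bootstrap` (p148968),
`stub_hr_sandwich` (p149048), `stub_hr_heightDeriv` (p149016), `stub_hr_slopeField` (p149041)
(cone algebra p148606 and null data p150493 enter through the sandwich and the preparations). -/
theorem stub_hr_assembly : ∀ (𝓑 : StationaryAFBlackHole.{0}) (U : Set 𝓑.carrier) (K : Π x : 𝓑.carrier, TangentSpace (𝓡 4) x), IsOpen U → 𝓑.horizon ⊆ U → ContMDiffOn (𝓡 4) ((𝓡 4).prod 𝓘(ℝ, E4)) ((⊤ : ℕ∞) : WithTop ℕ∞) (fun x ↦ (Bundle.TotalSpace.mk' E4 x (K x) : TangentBundle (𝓡 4) 𝓑.carrier)) U → (∀ p ∈ 𝓑.horizon, K p ≠ 0) → (∀ p ∈ 𝓑.horizon, 𝓑.metric.val p (K p) (K p) = 0) → (∀ p ∈ 𝓑.horizon, ∃ ε > (0 : ℝ), ∃ γ : ℝ → 𝓑.carrier,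 γ 0 = p ∧ IsMIntegralCurveOn γ K (Set.Ioo (-ε) ε) ∧ ∀ t ∈ Set.Ioo (-ε) ε, γ t ∈ 𝓑.horizon) → ∀ p ∈ 𝓑.horizon, ∃ W : Set 𝓑.carrier, IsOpen W ∧ p ∈ W ∧ W ⊆ U ∧ ∃ F : 𝓑.carrier → ℝ, ContMDiffOn (𝓡 4) 𝓘(ℝ, ℝ) ((⊤ : ℕ∞) : WithTop ℕ∞) F W ∧ (∀ x ∈ W, x ∈ 𝓑.horizon ↔ F x = 0) ∧ (∀ x ∈ W, x ∈ 𝓑.doc ↔ F x < 0) ∧ ∀ x ∈ W ∩ 𝓑.horizon, ∃ c : ℝ, c ≠ 0 ∧ ∀ w : TangentSpace (𝓡 4) x, mfderiv (𝓡 4) 𝓘(ℝ, ℝ) F x w = c * 𝓑.metric.val x (K x) w :=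
  exists_horizonDefiningFunction stub_hr_bootstrap stub_hr_sandwich stub_hr_heightDeriv stub_hr_slopeField

end Summit.FinalStateConjecture.FinalStateConjecture.Theorems.HawkingExtensionIsKerr.SketchIdeator2

end
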